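import Summits.QuantumFields.YangMills.Theorems.BalabanUVNodesN15TwoSpacingGluingCurvedKnitDefect
import Summits.QuantumFields.YangMills.Theorems.BalabanUVNodesN15CurvedLocalCoefLettersOfReg335UN
import HarnessLib

/-!
# THE GLUING STEP AT TWO LATTICE SPACINGS — (Γ15b) THE LIVE-`U` KNIT AT THE COVER, TWO GRIDS, IX: THE PER-CUBE GAUGES OF BOTH GRIDS AND THEIR (3.35) LETTERS FROM BAŁABAN's REGULARITY
# CLASS BY NAME — FILE 123's displayed rows `hu hu' hCloc hAloc hCloc' hAloc'` DISCHARGED from ONE `Reg335Cube` datum per cube and grid (dag-n15-c g15, FILE 126; N15 = NE2, s1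
# «background-layer OPERATOR ingredient»)

Cell `pub-ymgap`, seat `pub-ymgap-dag-n15-c` (R134 (a); HUMAN RULING D-0062), generation 15.  `bears_on: R4∕N15 · K3⁸ SpineGivenEndpointR13SepCoPHV (stmt-QuantumFields-27366)`.
Filed `--kind proof --supports stmt-QuantumFields-27366 --as helper` — COUNT-NEUTRAL.  One theorem; 0 `def`, 0 `sorry`.  Imports BY NAME FILE 123 `…TwoSpacingGluingCurvedKnitDefect` (`uN_idef_cvGlued`)
and dag-n15-w2 g6 `…CurvedLocalCoefLettersOfReg335UN` (`uN_exists_gauge_cutCoefLetters_of_reg335Cube`; through it lit-balaban r06 `B9Eq335RegularityClasses.Reg335Cube` = [B9] (3.35) on a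
cube).  The twin of FILE 125 for the two-grid capstone.  Nothing in the tree is modified.

WHAT.  ★★★ `uN_idef_cvGlued_of_reg335Cube` — FILE 123 with the per-cube unitary gauges of BOTH grids PRODUCED instead of displayed: bond fields `U` (coarse) and `U′` (fine) in the class
(3.35) on sets `Q_k ⊇` ∕ `Q′_k ⊇` the one-step neighbourhoods of the cut boxes (`χ_k ≠ 0` ∕ `χ′_k ≠ 0`) give gauges `w_k`, `w′_k` UNITARY EVERYWHERE with the (3.35) row letters of the
transformed bond variables where the cuts are non-zero (dag-n15-w2), bounded by `r_V` once `r_V` dominates the four displayed explicit bounds; FILE 123 then bounds, FOR THESE GAUGES, the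
η-defect of the glued operators by `D·((L^k)^{−1∕16} + o + o_W + r_D)·e^{−(δ∕16)d}` — with the conjugation laws of `P`, `P′`, the species fits `o_V`, the gauge fits `o_W` and `N_V`,
`N′_V`'s letters still displayed (pairing data and the lane's objects: [B9] (3.49)∕(3.68)∕(3.77)).

HONEST FRAMING ∕ LIMITS.  Two `choose` + one application; the class (3.35) per cube and grid is the HYPOTHESIS (as in [B9] Thm 3.1 ∕ 3.14); interior conditions `hQ`, `hQ′` displayed;
constants crude; MODEL carriers (finite doubled torus, flat cubes by images, abstract `P`, `N_V`); the SHAPE of [B9] Thm 3.14, not the printed theorem; nothing of [B5]∕[B6]∕[B9] asserted.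
NE2⁺ NOT PRINTED, NOT proved; N15 NOT discharged; K3⁸ OPEN, skeleton v6 untouched; counts of record UNMOVED (typed 28∕28 · discharged 5∕27); one finite 𝕋⁴ at fixed ε — NOT infinite
volume, NOT OS on ℝ⁴, NOT a mass gap, NOT Clay; R4 closes the conditional finite-𝕋⁴ rung `BalabanLadder.UV` only.  Restate-immune.
-/

noncomputable section

open scoped BigOperators Matrix Matrix.Norms.L2Operator

namespace Summit.QuantumFields.YangMills.BalabanUVNodes.N15.Gluing

open Real
open Literature.MathematicalPhysics.QuantumFieldTheory.Balaban1983to89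
open Literature.MathematicalPhysics.QuantumFieldTheory.Balaban1983to89.B11SectG (BlockNorm HasMaj)
open Literature.MathematicalPhysics.QuantumFieldTheory.Balaban1983to89.B6Prop26Gluing (mulOp)
open Literature.MathematicalPhysics.QuantumFieldTheory.Balaban1983to89.B6UnitTorusCarrier (unitTorusGeo)
open Literature.MathematicalPhysics.QuantumFieldTheory.Balaban1983to89.B9Eq335RegularityClasses (Reg335Cube)
open Literature.Barriers.QuantumFields (traceForm)
open Summit.QuantumFields.YangMills.BalabanUVNodes.N15.BackgroundLayer (covLapM tCoefA tCoefC)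
open Summit.QuantumFields.YangMills.BalabanUVNodes.N15.VectorPiece (bshiftEquiv kingPrV)
open Summit.QuantumFields.YangMills.BalabanUVNodes.N15.MatrixSpecies (mmulOp coordMat basisConst liftBlk liftMap)
open Literature.MathematicalPhysics.QuantumFieldTheory.Balaban1983to89.T4EtaRateDefect (idef)
open Literature.MathematicalPhysics.QuantumFieldTheory.Balaban1983to89.T4EtaRateCoeffDefect (pull)
open Summit.QuantumFields.YangMills.BalabanUVNodes.N15.CurvedSpecies (gaugePair uN_exists_gauge_cutCoefLetters_of_reg335Cube)

variable {d : ℕ}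

section Reg335

variable {L : ℕ} [NeZero L]

/-- ★★★ **THE η-DEFECT OF THE LIVE-`U` KNIT FOR BACKGROUNDS IN BAŁABAN's CLASS (3.35) PER CUBE, BOTH GRIDS** (FILE 123 `uN_idef_cvGlued` + dag-n15-w2
`uN_exists_gauge_cutCoefLetters_of_reg335Cube` on each grid): the six per-cube gauge rows `hu hu' hCloc hAloc hCloc' hAloc'` of FILE 123 are PRODUCED — on the coarse grid from
`Reg335Cube (bshiftEquiv M (L^k)) U L^{−k} (Q k) ξ C`, on the fine grid from `Reg335Cube (bshiftEquiv M (L^rL^k)) U′ (L^rL^k)^{−1} (Q′ k) ξ′ C′` — and for the resulting gauges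
`w_k`, `w′_k` (unitary everywhere) FILE 123's conclusion holds for every `P, P′, N_V, N′_V` with the displayed conjugation laws, fits and letters.  MODEL carriers; NOT [B9] Thm 3.14 as printed.
[cite: Balaban1985BackgroundPropagators, Thm 3.14 pp.426–427 (template), (3.34)–(3.35) p.396, Cor. 3.6 p.408, (3.62)–(3.65) pp.402–403; Balaban1984PropagatorsII, (2.133)–(2.136) p.247] -/
theorem uN_idef_cvGlued_of_reg335Cube (hL : Odd L ∧ 1 < L) (hL7 : 7 ≤ L) {a : ℝ} (ha : 0 < a) (ι : Type) [Fintype ι] [DecidableEq ι] :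
    ∃ δ w₀ R₀ θ₀ D : ℝ, 0 < δ ∧ 0 < R₀ ∧ 0 < θ₀ ∧
      ∀ (mv kk r : ℕ), 1 ≤ kk → w₀ ≤ ((L ^ mv : ℕ) : ℝ) →
      ∀ {mm : Type} [Fintype mm] [DecidableEq mm] [Nonempty mm] (e : Matrix mm mm ℂ ≃L[ℝ] (ι → ℝ)), (∀ A B : Matrix mm mm ℂ, traceForm A B = e A ⬝ᵥ e B) →
      ∀ (U : Fin (d + 1) → CvX d L mv kk hL → (Matrix mm mm ℂ)ˣ) (U' : Fin (d + 1) → CvX' d L mv kk r hL → (Matrix mm mm ℂ)ˣ),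
        (∀ μ x, (U μ x : Matrix mm mm ℂ) ∈ Matrix.unitaryGroup mm ℂ) → (∀ μ x', (U' μ x' : Matrix mm mm ℂ) ∈ Matrix.unitaryGroup mm ℂ) →
      ∀ (Q : (Fin (d + 1) → ZMod (2 * L)) → Set (CvX d L mv kk hL)) (Q' : (Fin (d + 1) → ZMod (2 * L)) → Set (CvX' d L mv kk r hL)) (ξ C ξ' C' : ℝ), 0 < ξ → 0 ≤ C → 0 < ξ' → 0 ≤ C' →
        (∀ k, Reg335Cube (bshiftEquiv (cvM d L mv kk hL) (L ^ kk)) U ((((L ^ kk : ℕ) : ℝ))⁻¹) (Q k) ξ C) →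
        (∀ k, Reg335Cube (bshiftEquiv (cvM d L mv kk hL) (L ^ r * L ^ kk)) U' ((((L ^ r * L ^ kk : ℕ) : ℝ))⁻¹) (Q' k) ξ' C') →
        (∀ k x, cvChi d L mv kk hL k x ≠ 0 → x ∈ Q k ∧ (∀ μ, bshiftEquiv (cvM d L mv kk hL) (L ^ kk) μ x ∈ Q k) ∧ (∀ μ, (bshiftEquiv (cvM d L mv kk hL) (L ^ kk) μ).symm x ∈ Q k)) →
        (∀ k x', cvChi' d L mv kk r hL k x' ≠ 0 → x' ∈ Q' k ∧ (∀ μ, bshiftEquiv (cvM d L mv kk hL) (L ^ r * L ^ kk) μ x' ∈ Q' k) ∧ (∀ μ, (bshiftEquiv (cvM d L mv kk hL) (L ^ r * L ^ kk) μ).symm x' ∈ Q' k)) →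
      ∀ (rV RN rD oV oN o oW : ℝ), 0 ≤ rV → 0 ≤ RN → 0 ≤ rD → 0 ≤ oV → 0 ≤ oN → 0 ≤ oW →
        Fintype.card ι * (@basisConst ι _ (Matrix mm mm ℂ) Matrix.frobeniusNormedAddCommGroup Matrix.frobeniusNormedSpace e * (2 * Real.sqrt (Fintype.card mm)) * (Real.sqrt (Fintype.card mm) * ((C / ξ) * Real.exp (((((L ^ kk : ℕ) : ℝ))⁻¹) * (C / ξ))))) ≤ rV →
        Fintype.card ι * (Fintype.card (Fin (d + 1)) * (Fintype.card ι * (@basisConst ι _ (Matrix mm mm ℂ) Matrix.frobeniusNormedAddCommGroup Matrix.frobeniusNormedSpace e * (2 * Real.sqrt (Fintype.card mm)) * (Real.sqrt (Fintype.card mm) * ((C / ξ) * Real.exp (((((L ^ kk : ℕ) : ℝ))⁻¹) * (C / ξ))))) ^ 2 + @basisConst ι _ (Matrix mm mm ℂ) Matrix.frobeniusNormedAddCommGroup Matrix.frobeniusNormedSpace e * (2 * Real.sqrt (Fintype.card mm)) * (Real.sqrt (Fintype.card mm) * ((C / ξ ^ 2) * Real.exp (((((L ^ kk : ℕ) : ℝ))⁻¹)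 * (C / ξ)))))) ≤ rV →
        Fintype.card ι * (@basisConst ι _ (Matrix mm mm ℂ) Matrix.frobeniusNormedAddCommGroup Matrix.frobeniusNormedSpace e * (2 * Real.sqrt (Fintype.card mm)) * (Real.sqrt (Fintype.card mm) * ((C' / ξ') * Real.exp (((((L ^ r * L ^ kk : ℕ) : ℝ))⁻¹) * (C' / ξ'))))) ≤ rV →
        Fintype.card ι * (Fintype.card (Fin (d + 1)) * (Fintype.card ι * (@basisConst ι _ (Matrix mm mm ℂ) Matrix.frobeniusNormedAddCommGroup Matrix.frobeniusNormedSpace e * (2 * Real.sqrt (Fintype.card mm)) * (Real.sqrt (Fintype.card mm) * ((C' / ξ') * Real.exp (((((L ^ r * L ^ kk : ℕ) : ℝ))⁻¹) * (C' / ξ'))))) ^ 2 + @basisConst ι _ (Matrix mm mm ℂ) Matrix.frobeniusNormedAddCommGroup Matrix.frobeniusNormedSpace e * (2 * Real.sqrt (Fintype.card mm)) * (Real.sqrt (Fintype.card mm) * ((C' / ξ' ^ 2) * Real.exp (((((L ^ r * L ^ kk : ℕ) : ℝ))⁻¹) * (C' / ξ')))))) ≤ rV →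
        rV * (1 + Fintype.card (Fin (d + 1) ⊕ Fin (d + 1))) + RN ≤ R₀ → oV * (1 + Fintype.card (Fin (d + 1) ⊕ Fin (d + 1))) + oN ≤ o →
      ∀ (θF : ℝ), θF ≤ θ₀ →
      ∃ (w : (Fin (d + 1) → ZMod (2 * L)) → CvX d L mv kk hL → Matrix mm mm ℂ) (w' : (Fin (d + 1) → ZMod (2 * L)) → CvX' d L mv kk r hL → Matrix mm mm ℂ),
        (∀ k x, (w k x)ᴴ * w k x = 1) ∧ (∀ k x', (w' k x')ᴴ * w' k x' = 1) ∧
        ∀ (P : (CvX d L mv kk hL × ι → ℝ) →ₗ[ℝ] (CvX d L mv kk hL × ι → ℝ)) (P' : (CvX' d L mv kk r hL × ι → ℝ) →ₗ[ℝ] (CvX' d L mv kk r hL × ι → ℝ))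
          (NV : (Fin (d + 1) → ZMod (2 * L)) → (CvX d L mv kk hL × ι → ℝ) →ₗ[ℝ] (CvX d L mv kk hL × ι → ℝ))
          (NV' : (Fin (d + 1) → ZMod (2 * L)) → (CvX' d L mv kk r hL × ι → ℝ) →ₗ[ℝ] (CvX' d L mv kk r hL × ι → ℝ)),
        (∀ k, mmulOp (fun x => coordMat e (ContinuousLinearMap.mulLeftRight ℝ (Matrix mm mm ℂ) (w k x) (w k x)ᴴ)) ∘ₗ P ∘ₗ mmulOp (fun x => (coordMat e (ContinuousLinearMap.mulLeftRight ℝ (Matrix mm mm ℂ) (w k x) (w k x)ᴴ))ᵀ) = (cvNL d L mv kk hL a ι) - NV k) →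
        (∀ k, mmulOp (fun x' => coordMat e (ContinuousLinearMap.mulLeftRight ℝ (Matrix mm mm ℂ) (w' k x') (w' k x')ᴴ)) ∘ₗ P' ∘ₗ mmulOp (fun x' => (coordMat e (ContinuousLinearMap.mulLeftRight ℝ (Matrix mm mm ℂ) (w' k x') (w' k x')ᴴ))ᵀ) = (cvNL' d L mv kk r hL a ι) - NV' k) →
        (∀ k x' i, ∑ j, |(cvChi' d L mv kk r hL k x' • tCoefC ((((L ^ r * L ^ kk : ℕ) : ℝ))⁻¹) (gaugePair (bshiftEquiv (cvM d L mv kk hL) (L ^ r * L ^ kk)) fun μ x' => coordMat e (ContinuousLinearMap.mulLeftRight ℝ (Matrix mm mm ℂ) (w' k x' * (U' μ x' : Matrix mm mm ℂ) * (w' k (bshiftEquiv (cvM d L mv kk hL) (L ^ r * L ^ kk) μ x'))ᴴ) (w' k x' * (U' μ x' : Matrix mm mm ℂ) *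
          (w' k (bshiftEquiv (cvM d L mv kk hL) (L ^ r * L ^ kk) μ x'))ᴴ)ᴴ)) x') i j - (cvChi d L mv kk hL k ((kingPrV L kk r (cvM d L mv kk hL)) x') • tCoefC ((((L ^ kk : ℕ) : ℝ))⁻¹) (gaugePair (bshiftEquiv (cvM d L mv kk hL) (L ^ kk)) fun μ x => coordMat e (ContinuousLinearMap.mulLeftRight ℝ (Matrix mm mm ℂ) (w k x * (U μ x : Matrix mm mm ℂ) *
          (w k (bshiftEquiv (cvM d L mv kk hL) (L ^ kk) μ x))ᴴ) (w k x * (U μ x : Matrix mm mm ℂ) * (w k (bshiftEquiv (cvM d L mv kk hL) (L ^ kk) μ x))ᴴ)ᴴ)) ((kingPrV L kk r (cvM d L mv kk hL)) x')) i j| ≤ oV) →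
        (∀ k j' x' i, ∑ j, |(cvChi' d L mv kk r hL k x' • tCoefA ((((L ^ r * L ^ kk : ℕ) : ℝ))⁻¹) (gaugePair (bshiftEquiv (cvM d L mv kk hL) (L ^ r * L ^ kk)) fun μ x' => coordMat e (ContinuousLinearMap.mulLeftRight ℝ (Matrix mm mm ℂ) (w' k x' * (U' μ x' : Matrix mm mm ℂ) * (w' k (bshiftEquiv (cvM d L mv kk hL) (L ^ r * L ^ kk) μ x'))ᴴ) (w' k x' * U' μ x'
          * (w' k (bshiftEquiv (cvM d L mv kk hL) (L ^ r * L ^ kk) μ x'))ᴴ)ᴴ)) j' x') i j - (cvChi d L mv kk hL k ((kingPrV L kk r (cvM d L mv kk hL)) x') • tCoefA ((((L ^ kk : ℕ) : ℝ))⁻¹) (gaugePair (bshiftEquiv (cvM d L mv kk hL) (L ^ kk)) fun μ x => coordMat e (ContinuousLinearMap.mulLeftRight ℝ (Matrix mm mm ℂ) (w k x * U μ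
          x * (w k (bshiftEquiv (cvM d L mv kk hL) (L ^ kk) μ x))ᴴ) (w k x * (U μ x : Matrix mm mm ℂ) * (w k (bshiftEquiv (cvM d L mv kk hL) (L ^ kk) μ x))ᴴ)ᴴ)) j' ((kingPrV L kk r (cvM d L mv kk hL)) x')) i j| ≤ oV) →
        (∀ k, HasMaj (CvNorm d L mv kk hL ι) (CvNorm d L mv kk hL ι) (mulOp (fun p : CvX d L mv kk hL × ι => cvPsi d L mv kk hL k p.1) ∘ₗ NV k ∘ₗ mulOp (fun p : CvX d L mv kk hL × ι => cvChi d L mv kk hL k p.1)) (fun y y' => RN * Real.exp (-(δ * (unitTorusGeo L kk (cvM d L mv kk hL)).dist y y')))) →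
        (∀ k, HasMaj (BlockNorm.ofBlocks (unitTorusGeo L kk (cvM d L mv kk hL)) (liftBlk (cvBlk d L mv kk hL ∘ (kingPrV L kk r (cvM d L mv kk hL))) ι)) (BlockNorm.ofBlocks (unitTorusGeo L kk (cvM d L mv kk hL)) (liftBlk (cvBlk d L mv kk hL ∘ (kingPrV L kk r (cvM d L mv kk hL))) ι)) (mulOp (fun p : CvX' d L mv kk r hL × ι => cvPsi' d L mv
          kk r hL k p.1) ∘ₗ NV' k ∘ₗ mulOp (fun p : CvX' d L mv kk r hL × ι => cvChi' d L mv kk r hL k p.1)) (fun y y' => RN * Real.exp (-(δ * (unitTorusGeo L kk (cvM d L mv kk hL)).dist y y')))) →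
        (∀ k, HasMaj (CvNorm d L mv kk hL ι) (BlockNorm.ofBlocks (unitTorusGeo L kk (cvM d L mv kk hL)) (liftBlk (cvBlk d L mv kk hL ∘ (kingPrV L kk r (cvM d L mv kk hL))) ι)) (idef (pull (liftMap (kingPrV L kk r (cvM d L mv kk hL)) ι)) (pull (liftMap (kingPrV L kk r (cvM d L mv kk hL)) ι)) (mulOp (fun p : CvX' d L mv kk r hL × ι =>
          cvPsi' d L mv kk r hL k p.1) ∘ₗ NV' k ∘ₗ mulOp (fun p : CvX' d L mv kk r hL × ι => cvChi' d L mv kk r hL k p.1)) (mulOp (fun p : CvX d L mv kk hL × ι => cvPsi d L mv kk hL k p.1) ∘ₗ NV k ∘ₗ mulOp (fun p : CvX d L mv kk hL × ι => cvChi d L mv kk hL k p.1))) (fun y y' => oN * Real.exp (-(δ * (unitTorusGeo L kk (cvM d L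
          mv kk hL)).dist y y')))) →
        (∀ k, HasMaj (CvNorm d L mv kk hL ι) (CvNorm d L mv kk hL ι) ((LinearMap.id - mulOp (fun p : CvX d L mv kk hL × ι => cvPsi d L mv kk hL k p.1)) ∘ₗ NV k ∘ₗ mulOp (fun p : CvX d L mv kk hL × ι => cvChi d L mv kk hL k p.1)) (fun y y' => θF * Real.exp (-(δ * (unitTorusGeo L kk (cvM d L mv kk hL)).dist y y')))) →
        (∀ k, HasMaj (BlockNorm.ofBlocks (unitTorusGeo L kk (cvM d L mv kk hL)) (liftBlk (cvBlk d L mv kk hL ∘ (kingPrV L kk r (cvM d L mv kk hL))) ι)) (BlockNorm.ofBlocks (unitTorusGeo L kk (cvM d L mv kk hL)) (liftBlk (cvBlk d L mv kk hL ∘ (kingPrV L kk r (cvM d L mv kk hL))) ι)) ((LinearMap.id - mulOp (fun p : CvX' d L mv kk r hL × ι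
          => cvPsi' d L mv kk r hL k p.1)) ∘ₗ NV' k ∘ₗ mulOp (fun p : CvX' d L mv kk r hL × ι => cvChi' d L mv kk r hL k p.1)) (fun y y' => θF * Real.exp (-(δ * (unitTorusGeo L kk (cvM d L mv kk hL)).dist y y')))) →
        (∀ k, HasMaj (CvNorm d L mv kk hL ι) (BlockNorm.ofBlocks (unitTorusGeo L kk (cvM d L mv kk hL)) (liftBlk (cvBlk d L mv kk hL ∘ (kingPrV L kk r (cvM d L mv kk hL))) ι)) (idef (pull (liftMap (kingPrV L kk r (cvM d L mv kk hL)) ι)) (pull (liftMap (kingPrV L kk r (cvM d L mv kk hL)) ι)) ((LinearMap.id - mulOp (fun p : CvX' d L mv kk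
          r hL × ι => cvPsi' d L mv kk r hL k p.1)) ∘ₗ NV' k ∘ₗ mulOp (fun p : CvX' d L mv kk r hL × ι => cvChi' d L mv kk r hL k p.1)) ((LinearMap.id - mulOp (fun p : CvX d L mv kk hL × ι => cvPsi d L mv kk hL k p.1)) ∘ₗ NV k ∘ₗ mulOp (fun p : CvX d L mv kk hL × ι => cvChi d L mv kk hL k p.1))) (fun y y' => rD * Real.exp (-(δ *
          (unitTorusGeo L kk (cvM d L mv kk hL)).dist y y')))) →
        (∀ k x' i, ∑ j, |coordMat e (ContinuousLinearMap.mulLeftRight ℝ (Matrix mm mm ℂ) (w' k x') (w' k x')ᴴ) i j - coordMat e (ContinuousLinearMap.mulLeftRight ℝ (Matrix mm mm ℂ) (w k ((kingPrV L kk r (cvM d L mv kk hL)) x')) (w k ((kingPrV L kk r (cvM d L mv kk hL)) x'))ᴴ) i j| ≤ oW) →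
        (∀ k x' i, ∑ j, |(coordMat e (ContinuousLinearMap.mulLeftRight ℝ (Matrix mm mm ℂ) (w' k x') (w' k x')ᴴ))ᵀ i j - (coordMat e (ContinuousLinearMap.mulLeftRight ℝ (Matrix mm mm ℂ) (w k ((kingPrV L kk r (cvM d L mv kk hL)) x')) (w k ((kingPrV L kk r (cvM d L mv kk hL)) x'))ᴴ))ᵀ i j| ≤ oW) →
        HasMaj (CvNorm d L mv kk hL ι) (BlockNorm.ofBlocks (unitTorusGeo L kk (cvM d L mv kk hL)) (liftBlk (cvBlk d L mv kk hL ∘ kingPrV L kk r (cvM d L mv kk hL)) ι)) (idef (pull (liftMap (kingPrV L kk r (cvM d L mv kk hL)) ι)) (pull (liftMap (kingPrV L kk r (cvM d L mv kk hL)) ι))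
            (cvGlued' d L mv kk r hL a ((((L ^ r * L ^ kk : ℕ) : ℝ))⁻¹) ι e w' (fun μ x => (U' μ x : Matrix mm mm ℂ)) P' NV') (cvGlued d L mv kk hL a ((((L ^ kk : ℕ) : ℝ))⁻¹) ι e w (fun μ x => (U μ x : Matrix mm mm ℂ)) P NV)) (fun y y' => D * ((((L ^ kk : ℕ) : ℝ)) ^ (-(1 / 16 : ℝ)) + (o + (oW + rD))) * Real.exp (-(δ / 16 * (unitTorusGeo L kk (cvM d L mv kk hL)).dist y y'))) := by
  obtain ⟨δ, w₀, R₀, θ₀, D, hδ, hR₀, hθ₀, H⟩ := uN_idef_cvGlued (d := d) hL hL7 ha ι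
  refine ⟨δ, w₀, R₀, θ₀, D, hδ, hR₀, hθ₀, fun mv kk r hk hw₀ => ?_⟩
  intro mm _ _ _ e he U U' hU hU' Q Q' ξ C ξ' C' hξ hC hξ' hC' h335 h335' hQ hQ' rV RN rD oV oN o oW hrV hRN hrD hoV hoN hoW hrA hrC hrA' hrC' hRle hole θF hθle
  have hLpos : 0 < L := Nat.pos_of_ne_zero (NeZero.ne L)
  have hη : (0 : ℝ) < ((((L ^ kk : ℕ) : ℝ))⁻¹) := inv_pos.mpr (Nat.cast_pos.mpr (pow_pos hLpos kk))
  have hη' : (0 : ℝ) < ((((L ^ r * L ^ kk : ℕ) : ℝ))⁻¹) := inv_pos.mpr (Nat.cast_pos.mpr (Nat.mul_pos (pow_pos hLpos r) (pow_pos hLpos kk)))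
  choose w hwu hwC hwA using fun k => uN_exists_gauge_cutCoefLetters_of_reg335Cube e (bshiftEquiv (cvM d L mv kk hL) (L ^ kk)) U he hη hU hξ hC (h335 k) (hQ k) hrA hrC
  choose w' hwu' hwC' hwA' using fun k => uN_exists_gauge_cutCoefLetters_of_reg335Cube e (bshiftEquiv (cvM d L mv kk hL) (L ^ r * L ^ kk)) U' he hη' hU' hξ' hC' (h335' k) (hQ' k) hrA' hrC'
  refine ⟨w, w', fun k x => hwu k x, fun k x' => hwu' k x', fun P P' NV NV' hP hP' hfitC hfitA hNVcut hNVcut' hDNV hfarN hfarN' hDfarN hfitW hfitWT => ?_⟩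
  exact H mv kk r hk hw₀ e he w w' (fun k x => hwu k x) (fun k x' => hwu' k x') (fun μ x => (U μ x : Matrix mm mm ℂ)) (fun μ x' => (U' μ x' : Matrix mm mm ℂ)) P P' NV NV'
    rV RN θF rD oV oN o oW hrV hRN hrD hoV hoN hoW hRle hole hθle hP hP' (fun k => hwC k) (fun k => hwA k) (fun k => hwC' k) (fun k => hwA' k) hfitC hfitA hNVcut hNVcut' hDNV hfarN hfarN' hDfarN hfitW hfitWT

end Reg335

end Summit.QuantumFields.YangMills.BalabanUVNodes.N15.Gluing

end
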